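import Summits.CriticalPhenomena.SAWScalingLimit.Theses.SAWReversalUpgrade
import Summits.CriticalPhenomena.SAWScalingLimit.Theorems.SAWReversalUpgradeAttachNoReturnPolyline
import HarnessLib

/-!
# The residual `CollarReturnAvoidance` of line `SketchIdeator2` is a weakening of the crux
`SAWReversalUpgrade.NoDeepReturn` (stmt-CriticalPhenomena-18004, route `SAWReversalUpgrade`,
line `SketchIdeator2` / idea `naked-root-localisation`)

Landing target:
`Summits/CriticalPhenomena/SAWScalingLimit/Theorems/SAWReversalUpgradeNoDeepReturnCollarOfCrux.lean`
(`--supports stmt-CriticalPhenomena-18004`).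

The line's registered residual stub `stub_collarReturnAvoidance`
(`Cruxes/NoDeepReturn/Lines/SketchIdeator2.lean`) asks: for every Dobrushin domain `(D; a, b)`,
endpoint approximation and `ε, η > 0` there are `κ ∈ (0, 1)` and `r₀ > 0` such that for every
`ρ ∈ (0, r₀]` and all small `δ` the critical SAW law gives mass `≤ η` to the walks with a vertex
`ε`-far from `a = D.pt 0` and a LATER vertex that is `ρ`-close to `a` and NOT Stolz-joined to the
root `a_δ` (no lattice walk of `D_δ` from it to `a_δ` through vertices `w` of the `ρ`-ball with
`κ · dist(δw, δa_δ) ≤ infDist(δw, Dᶜ)`).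

**This file documents, kernel-checked, that the residual is implied by the crux itself**
(`collarReturnAvoidance_of_noDeepReturn`): given `(ε, η)` take the crux's radius `r`, ANY
`κ ∈ (0, 1)` (we take `κ = 1/2`; the `∀ κ` form is `collarReturnAvoidance_of_noDeepReturn_all`)
and `r₀ := r`; the residual event at `ρ ≤ r` is contained in the crux's polyline event because

* vertex events are polyline events (`exists_lt_toCurve_of_exists_lt_getVert`): the dyadic
  polyline `γ.walk.toCurve (meshPoint δ)` of `LatticeInterface.lean` is the uniform polyline run
  with the dyadic clock (`AttachNoReturn.toCurve_apply_eq_uniform_clock`, `PolylineUniform.lean`);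
  the clock is continuous and monotone from `0` to `|γ|`, so every vertex index `k ≤ |γ|` is a
  clock value (`exists_clock_eq_nat`, intermediate value theorem), the polyline then sits at the
  `k`-th mesh point (`toCurve_apply_of_clock_eq`), and indices `i < j` are met at times `s < t`
  (`exists_lt_toCurve_eq_getVert`);
* hence the VERTEX form of the crux (`noDeepReturn_vertex`), of which the residual event is a
  sub-event (drop the non-Stolz clause, `ρ ≤ r`).

So the residual is exactly as safe as the crux (itself a consequence of the conjunct
`SAWScalingLimit`, `Cruxes/NoDeepReturn/NoDeepReturnNecessary.lean`), and no cheaper: for a domain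
with an outward cusp at `a` the Stolz-joined set of `a_δ` shrinks to a ball of radius
`O(dist(δa_δ, a)² / κ + δ) → 0` around `δa_δ`, so there the residual carries the whole crux event
minus returns to a vanishing neighbourhood of the root. [folklore]
-/

noncomputable section

namespace Summit.CriticalPhenomena.SAWScalingLimit.Theorems.NoDeepReturn.NakedRoot

open MeasureTheory Filter Topology Set Metric
open scoped ENNReal
open Literature.Probability.LatticeModels (Site meshPoint discreteDomainGraph)
open Literature.Probability.RandomPlanarGeometry
open Literature.Probability.RandomPlanarGeometry.SAW
open Literature.Probability.RandomPlanarGeometry.Polyline (clock uniform monotone_clock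
  continuous_clock clock_zero clock_one uniform_zero)
open Summit.CriticalPhenomena.SAWScalingLimit.Theorems.AttachNoReturn (toCurve_apply_eq_uniform_clock
  uniform_walk_apply_add)

/-! ### Vertices are polyline points, met in index order -/

section General

variable {V E : Type*} [AddCommGroup E] [Module ℝ E] [TopologicalSpace E] [ContinuousAdd E]
  [ContinuousSMul ℝ E] {G : SimpleGraph V} {u v : V}

omit [AddCommGroup E] [Module ℝ E] [TopologicalSpace E] [ContinuousAdd E] [ContinuousSMul ℝ E] in
/-- Every integer level `k ≤ n` is a value of the dyadic clock `clock n` on `[0, 1]` (the clock is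
continuous with `clock n 0 = 0`, `clock n 1 = n`; intermediate value theorem). [folklore] -/
theorem exists_clock_eq_nat (n k : ℕ) (hk : k ≤ n) : ∃ t : unitInterval, clock n t = k := by
  have h := intermediate_value_Icc (zero_le_one' ℝ) (continuous_clock n).continuousOn
  rw [clock_zero, clock_one] at h
  obtain ⟨t, ht, htk⟩ :=
    h (show ((k : ℕ) : ℝ) ∈ Icc (0 : ℝ) (n : ℝ) from ⟨Nat.cast_nonneg k, Nat.cast_le.2 hk⟩)
  exact ⟨⟨t, ht⟩, htk⟩

/-- At a time where the dyadic clock shows the integer `k ≤ |w|`, the polyline of the walk `w` sits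
at the embedded `k`-th vertex `emb (w.getVert k)`. [folklore] -/
theorem toCurve_apply_of_clock_eq (emb : V → E) (w : G.Walk u v) {k : ℕ} (hk : k ≤ w.length)
    {t : unitInterval} (ht : clock w.length t = k) :
    w.toCurve emb t = emb (w.getVert k) := by
  rw [toCurve_apply_eq_uniform_clock, ht]
  rcases lt_or_eq_of_le hk with hlt | rfl
  · -- `k < |w|`: start of the `k`-th edge
    have h := uniform_walk_apply_add emb w hlt (s := 0) ⟨le_rfl, zero_le_one⟩
    rw [add_zero] at h
    rw [h, AffineMap.lineMap_apply_zero]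
  · -- `k = |w|`: end of the last edge (or the trivial walk)
    rcases Nat.eq_zero_or_pos w.length with h0 | hpos
    · rw [h0, Nat.cast_zero, uniform_zero, SimpleGraph.Walk.getVert_zero]
    · have h := uniform_walk_apply_add emb w (i := w.length - 1) (by omega) (s := 1)
        ⟨zero_le_one, le_rfl⟩
      have hcast : ((w.length - 1 : ℕ) : ℝ) + 1 = (w.length : ℝ) := by
        rw [Nat.cast_sub (Nat.one_le_of_lt hpos), Nat.cast_one]
        ring
      rw [hcast] at h
      rw [h, AffineMap.lineMap_apply_one, Nat.sub_add_cancel (Nat.one_le_of_lt hpos)]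

/-- Two vertices `w_i`, `w_j` with `i < j ≤ |w|` are met by the polyline of `w` at times `s < t`
(the clock is monotone, so clock values `i < j` force `s < t`). [folklore] -/
theorem exists_lt_toCurve_eq_getVert (emb : V → E) (w : G.Walk u v) {i j : ℕ} (hij : i < j)
    (hj : j ≤ w.length) :
    ∃ s t : unitInterval, s < t ∧ w.toCurve emb s = emb (w.getVert i) ∧
      w.toCurve emb t = emb (w.getVert j) := by
  obtain ⟨s, hs⟩ := exists_clock_eq_nat w.length i (hij.le.trans hj)
  obtain ⟨t, ht⟩ := exists_clock_eq_nat w.length j hj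
  refine ⟨s, t, ?_, toCurve_apply_of_clock_eq emb w (hij.le.trans hj) hs,
    toCurve_apply_of_clock_eq emb w hj ht⟩
  by_contra hst
  have hts : ((t : ℝ) : ℝ) ≤ s := Subtype.coe_le_coe.2 (not_lt.1 hst)
  have hmono := monotone_clock w.length hts
  rw [hs, ht] at hmono
  exact absurd (by exact_mod_cast hmono : j ≤ i) (not_le.2 hij)

/-- **Vertex events are polyline events.** If some vertex of the walk satisfies `P` and a LATER
vertex satisfies `Q` (after embedding), then the polyline of the walk satisfies `P` at some time and
`Q` at a strictly later time. [folklore] -/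
theorem exists_lt_toCurve_of_exists_lt_getVert (emb : V → E) (w : G.Walk u v) {P Q : E → Prop}
    (h : ∃ i j : ℕ, i < j ∧ j ≤ w.length ∧ P (emb (w.getVert i)) ∧ Q (emb (w.getVert j))) :
    ∃ s t : unitInterval, s < t ∧ P (w.toCurve emb s) ∧ Q (w.toCurve emb t) := by
  obtain ⟨i, j, hij, hj, hP, hQ⟩ := h
  obtain ⟨s, t, hst, hs, ht⟩ := exists_lt_toCurve_eq_getVert emb w hij hj
  refine ⟨s, t, hst, ?_, ?_⟩
  · rw [hs]; exact hP
  · rw [ht]; exact hQ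

end General

/-! ### The vertex form of the crux and the residual -/

/-- **Vertex form of the crux `NoDeepReturn`.** Under `NoDeepReturn`, for every Dobrushin domain,
endpoint approximation and `ε, η > 0` there is `r > 0` such that for all small `δ` the critical SAW
law gives mass `≤ η` to the walks having a VERTEX `ε`-far from `a = D.pt 0` and a LATER vertex
`r`-close to `a` (the vertex event is contained in the crux's polyline event by
`exists_lt_toCurve_of_exists_lt_getVert`). [folklore] -/
theorem noDeepReturn_vertex
    (h : Summit.CriticalPhenomena.SAWScalingLimit.Theses.SAWReversalUpgrade.NoDeepReturn) :
    ∀ (D : DobrushinDomain) (a b : ℝ → Site 2), IsEndpointApprox D a b →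
      ∀ ε : ℝ, 0 < ε → ∀ η : ℝ, 0 < η → ∃ r : ℝ, 0 < r ∧ ∀ᶠ δ in 𝓝[>] (0 : ℝ),
        law D.carrier δ (a δ) (b δ) {γ | ∃ i j : ℕ, i < j ∧ j ≤ γ.walk.length ∧
          ε ≤ dist (meshPoint δ (γ.walk.getVert i)) (D.pt 0) ∧
          dist (meshPoint δ (γ.walk.getVert j)) (D.pt 0) ≤ r} ≤ ENNReal.ofReal η := by
  intro D a b hab ε hε η hη
  obtain ⟨r, hr, hev⟩ := h D a b hab ε hε η hη
  refine ⟨r, hr, ?_⟩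
  filter_upwards [hev] with δ hδ
  refine le_trans (measure_mono fun γ hγ => ?_) hδ
  exact exists_lt_toCurve_of_exists_lt_getVert (meshPoint δ) γ.walk
    (P := fun z => ε ≤ dist z (D.pt 0)) (Q := fun z => dist z (D.pt 0) ≤ r) hγ

/-- **The residual from the crux, for EVERY aperture `κ`.** Under `NoDeepReturn`, for every
Dobrushin domain, endpoint approximation, `ε, η > 0` and every `κ` (no sign or size condition is
needed) there is `r₀ > 0` (the crux's radius) such that for every `ρ ≤ r₀` and all small `δ` the
law of "a vertex `ε`-far from `a`, a LATER vertex `ρ`-close to `a` and not Stolz-joined to `a_δ`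
with aperture `κ` inside the `ρ`-ball" is `≤ η`: drop the non-Stolz clause and use `ρ ≤ r₀`.
[folklore] -/
theorem collarReturnAvoidance_of_noDeepReturn_all
    (h : Summit.CriticalPhenomena.SAWScalingLimit.Theses.SAWReversalUpgrade.NoDeepReturn) :
    ∀ (D : DobrushinDomain) (a b : ℝ → Site 2), IsEndpointApprox D a b →
      ∀ ε : ℝ, 0 < ε → ∀ η : ℝ, 0 < η → ∀ κ : ℝ, ∃ r₀ : ℝ, 0 < r₀ ∧
        ∀ ρ : ℝ, ρ ≤ r₀ → ∀ᶠ δ in 𝓝[>] (0 : ℝ),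
          law D.carrier δ (a δ) (b δ) {γ | ∃ i j : ℕ, i < j ∧ j ≤ γ.walk.length ∧
            ε ≤ dist (meshPoint δ (γ.walk.getVert i)) (D.pt 0) ∧
            dist (meshPoint δ (γ.walk.getVert j)) (D.pt 0) ≤ ρ ∧
            ¬ ∃ p : (discreteDomainGraph D.carrier δ).Walk (γ.walk.getVert j) (a δ),
                ∀ w ∈ p.support, dist (meshPoint δ w) (D.pt 0) ≤ ρ ∧
                  κ * dist (meshPoint δ w) (meshPoint δ (a δ)) ≤
                    infDist (meshPoint δ w) D.carrierᶜ} ≤ ENNReal.ofReal η := by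
  intro D a b hab ε hε η hη κ
  obtain ⟨r, hr, hev⟩ := noDeepReturn_vertex h D a b hab ε hε η hη
  refine ⟨r, hr, fun ρ hρr => ?_⟩
  filter_upwards [hev] with δ hδ
  refine le_trans (measure_mono ?_) hδ
  rintro γ ⟨i, j, hij, hj, hfar, hclose, -⟩
  exact ⟨i, j, hij, hj, hfar, hclose.trans hρr⟩

/-- **The registered residual `stub_collarReturnAvoidance` of line `SketchIdeator2` is a weakening
of the crux `NoDeepReturn`** (statement of the stub verbatim as the conclusion): take the crux's
radius `r` for `(ε, η)`, `κ := 1/2`, `r₀ := r`; for `ρ ≤ r₀` the residual event (vertex `ε`-far,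
later vertex `ρ`-close and not Stolz-joined to the root) is a sub-event of the vertex form of the
crux, itself inside the crux's polyline event. [folklore] -/
theorem collarReturnAvoidance_of_noDeepReturn :
    Summit.CriticalPhenomena.SAWScalingLimit.Theses.SAWReversalUpgrade.NoDeepReturn →
    ∀ (D : DobrushinDomain) (a b : ℝ → Site 2), IsEndpointApprox D a b →
      ∀ ε : ℝ, 0 < ε → ∀ η : ℝ, 0 < η → ∃ κ : ℝ, 0 < κ ∧ κ < 1 ∧ ∃ r₀ : ℝ, 0 < r₀ ∧
        ∀ ρ : ℝ, 0 < ρ → ρ ≤ r₀ → ∀ᶠ δ in 𝓝[>] (0 : ℝ),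
          law D.carrier δ (a δ) (b δ) {γ | ∃ i j : ℕ, i < j ∧ j ≤ γ.walk.length ∧
            ε ≤ dist (meshPoint δ (γ.walk.getVert i)) (D.pt 0) ∧
            dist (meshPoint δ (γ.walk.getVert j)) (D.pt 0) ≤ ρ ∧
            ¬ ∃ p : (discreteDomainGraph D.carrier δ).Walk (γ.walk.getVert j) (a δ),
                ∀ w ∈ p.support, dist (meshPoint δ w) (D.pt 0) ≤ ρ ∧
                  κ * dist (meshPoint δ w) (meshPoint δ (a δ)) ≤
                    infDist (meshPoint δ w) D.carrierᶜ} ≤ ENNReal.ofReal η := by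
  intro h D a b hab ε hε η hη
  obtain ⟨r₀, hr₀, hres⟩ := collarReturnAvoidance_of_noDeepReturn_all h D a b hab ε hε η hη (1 / 2)
  exact ⟨1 / 2, one_half_pos, one_half_lt_one, r₀, hr₀, fun ρ _ hρ => hres ρ hρ⟩

end Summit.CriticalPhenomena.SAWScalingLimit.Theorems.NoDeepReturn.NakedRoot

end
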